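/-
Copyright (c) 2026 the pub-hodgecm-mathlib formalisation cell (harness21).  Prover seat hodgecm-mathlib-LH10-p01 (g13): road M6 → F5 → dyadic chain of `stub_DyUnramCore` (D-UNR),
site (L2-3) «THE WALL», row 3 «ORDER-DEEP-θ» of CENSUS-L23-CM v1 (LH10-p01 (g12)) — the θ-twin of ★ N2′ `shifted_order_memberships_of_deep`; 2026-09-03.
-/
import Literature.NumberTheory.Rogawski1990.TypeTwoCayleyShiftOrderCM       -- ★ N2 (F0P2-p06 (g10)): `smul_units_conj_add_smul_one`, `units_conj_nonsing_inv`; brings ★ γ₃ (`map_smul_add_smul_one`, `isUnit_localRing_of_ne_zero_of_subsingleton`), γ₂ (`conj_mem_adjoin_of_mem_adjoin`, `map_nonsing_inv_of_isUnit`), γ₁ (`shift_parameter_facts`), `conjLocal_apply_eq_of_smul_eq`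
import Literature.NumberTheory.Automorphic.UnitaryLatticeTreeLevelShift       -- ★ p845386: `v_det_eq_one_of_forall_v_sub_one_lt_one` (`M ≡ 1 (𝔪)` ⇒ `|det M| = 1`)
import Literature.NumberTheory.Automorphic.MatrixHermitianMoebiusShiftOrder    -- ★ P4 p853652 (LH10-p01 (g12)): `hermitianMoebius_mem_adjoin`, `hermitianMoebius_inv_mem_adjoin`, `mem_adjoin_hermitianMoebius` (the 2-free shifted order)
import Literature.NumberTheory.Automorphic.TypeTwoHermitianMoebiusShiftFrame   -- ★ P3 p853657 (LH10-p01 (g12)): `hermitianMoebius_one_add_smul_eq`, `valued_map_eq_one_of_add_map_eq_one`; brings ★ P2 `smul_one_add_smul_add_smul_one_of_add_eq`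
import Literature.NumberTheory.Rogawski1990.TypeTwoHermitianShiftCM          -- ★ p853677 (LH4-p01 (g12)): the θ-carriers; brings ★ P1 `moebius_conj'` and ★ p853671 `map_genMoebius`
import HarnessLib

/-!
# The HERMITIAN-shifted order at a CM place for a 2-deep `γ_H`, TYPE-FREE and 2-FREE:
# `φ_θ(δ)_w, φ_θ(δ)_w⁻¹ ∈ 𝒪_w[1 + c_w⁻¹(δ_w − 1)]` and `1 + c_w⁻¹(δ_w − 1) ∈ 𝒪_w[φ_θ(δ)_w]`

Topic `NumberTheory/Rogawski1990`; namespace `Literature.NumberTheory.Rogawski1990`.  THEOREMS ONLY (no definition, no instance, no notation, no named fact, no `sorry`); kernel lane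
`--supports stmt-HodgeConjecture-24833`.  Cell `pub/hodgecm-mathlib` (D-0151), crux H413 = `stmt-HodgeConjecture-24833`; road M6 → F5 → the dyadic chain of organ (D-UNR)
`stub_DyUnramCore`, LEVEL TWO, site (L2-3) «THE WALL» = ★ `liftInterior_of_levelTwo` with its `h2 : IsUnit 2` deleted.  Row 3 of CENSUS-L23-CM v1 (LH10-p01 (g12)): the N3
transport ★ `classOrbitalIntegral_levelOneIndicator_eq_shift` consumes the three shifted-order memberships `hu hu′ hX` of ★ N2′ `shifted_order_memberships_of_deep`, whose σ-FIXED
Cayley shift `φ_c = ((c+1)·_ + (c−1))((c−1)·_ + (c+1))⁻¹` needs `|2|_w = 1` (denominators `2·1 + (c ± 1)W`, ★ α `mem_adjoin_moebius (h2 : 2 unit)`).  THIS FILE is the θ-twin: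
the HERMITIAN shift `φ_θ(M) = (θ•M + (c−θ)•1)((c−θ′)•M + θ′•1)⁻¹` with `θ′ = σθ`, `θ + θ′ = 1`, `θ` integral (such `θ` exists at every unramified inert `w`, ★ LH7 L1
`exists_conjLocal_add_self_eq_one`), at ANY residue characteristic.

THE MATHEMATICS (★ N2′'s proof with the θ-heads of ★ P3∕P4 substituted).  `ι(γ_H)_w = 1 + c_w·W`, `W = c_w⁻¹(ι(γ_H)_w − 1)`; 2-deepness gives `W ≡ 0 (mod c_w)` entrywise, so
`N₊ = 1 + θ_w W`, `N₋ = 1 + (c_w − θ′_w)W` have UNIT determinants (★ `v_det_eq_one_of_forall_v_sub_one_lt_one`; no `2`).  ★ P3 `hermitianMoebius_one_add_smul_eq`: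
`φ_θ(ι(γ_H)_w) = N₊N₋⁻¹ =: Y₀` (both sides of `φ_θ` at `1 + c•W` are `c` times a cofactor, since `θ + (c−θ) = c = (c−θ′) + θ′`).  ★ P4: `Y₀, Y₀⁻¹ ∈ 𝒪_w[W]`
(`hermitianMoebius_mem_adjoin`, `…_inv_…`) and `W ∈ 𝒪_w[Y₀]` (`mem_adjoin_hermitianMoebius`, which needs the units `1 − c_w` and `c_w − θ′_w` — ★ P3 §6
`valued_map_eq_one_of_add_map_eq_one`: `|c_w − σθ_w| = 1` because `|c_w| < 1` and `|σθ_w| = 1` — and `θ_w, θ′_w, c_w ∈ 𝒪_w`, NOT `2`).  A match `δ` is `x·ι(γ_H)·x⁻¹` in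
`GL₃(E_v)`, so `δ_w = x_w ι_w x_w⁻¹`, `φ_θ(δ)_w = x_w Y₀ x_w⁻¹` (★ p853671 `map_genMoebius`, ★ P1 `moebius_conj'`), `1 + c_w⁻¹(δ_w − 1) = x_w(1 + W)x_w⁻¹`, and conjugation
transports the memberships (★ γ₂ `conj_mem_adjoin_of_mem_adjoin`).  The integers are the `Valued` integers `𝒪[L_w]` (N3's currency).  Count-neutral CM glue; nothing printed
is asserted.  HONEST LABEL: L2-3 remains THE WALL at the CM-glue layer until every row of CENSUS-L23-CM is paid and `stub_liftInterior_dy` lands; HC_CM is proved only modulo the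
7 printed citations (2 remaining: hLiu418 = stmt-HodgeConjecture-24832, h413 = stmt-HodgeConjecture-24833) until rung 0 closes.

## References
* [Kottwitz1986BaseChangeUnits] R. E. Kottwitz, *Base change for unit elements of Hecke algebras*, Compositio Math. 60 (1986): §2 pp. 244–247.
* [Rogawski1990] J. D. Rogawski, *Automorphic Representations of Unitary Groups in Three Variables*, Ann. of Math. Stud. 123 (1990): §4.9 Prop. 4.9.1 (b) p. 55.
* [Serre1980Trees] J.-P. Serre, *Trees* (1980): Ch. II §1.1–1.2.
-/

set_option autoImplicit false

noncomputable section

open NumberField IsDedekindDomain Matrix Polynomial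
open scoped MatrixGroups WithZero Valued

namespace Literature.NumberTheory.Rogawski1990

open Literature.NumberTheory.Automorphic Literature.NumberTheory.Automorphic.UnitaryGroup Literature.NumberTheory.Automorphic.MoebiusShift
  Literature.NumberTheory.Automorphic.UnitaryLatticeTree Literature.NumberTheory.GaloisRepresentations Literature.NumberTheory.NumberFields

set_option maxHeartbeats 1600000 in
-- the carriers' types are large (same budget as ★ N2′)
/-- **«ORDER-DEEP-θ» — THE HERMITIAN-SHIFTED ORDER MEMBERSHIPS, TYPE-FREE, 2-FREE** (θ-twin of ★ N2′ `shifted_order_memberships_of_deep`): at a non-split place (`σ • w = w`),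
for `|c_w| = exp(−1)`, `θ′ = σθ` (`σ = c ⊗ 1` on `E_v`), `θ + θ′ = 1`, `|θ_w| ≤ 1`, a 2-DEEP `γ_H` (`ι_v(γ_H)_w ≡ 1 (mod c_w²)` entrywise), a match `δ` of `γ_H` and `δ′` with
matrix `φ_θ(δ) = (θ•δ + (c−θ)•1)((c−θ′)•δ + θ′•1)⁻¹`: with `Y := (δ′)_w`, `X_δ := 1 + c_w⁻¹((δ)_w − 1)`, `Y ∈ 𝒪_w[X_δ]`, `Y⁻¹ ∈ 𝒪_w[X_δ]`, `X_δ ∈ 𝒪_w[Y]`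
(`𝒪_w` the `Valued` integers).  No `|2|_w = 1`: the denominators `1 + θ_w W`, `1 + (c_w − θ′_w)W` are unimodular by deepness alone, and the order identity is ★ P4's.
[cite: Kottwitz1986BaseChangeUnits, §2 pp. 244–247] [cite: Rogawski1990, §4.9 Prop. 4.9.1 (b) p. 55] [cite: Serre1980Trees, Ch. II §1.1–1.2] -/
theorem hermitianShifted_order_memberships_of_deep (L : Type) [Field L] [NumberField L] [IsCMField L] (H' : Matrix (Fin 3) (Fin 3) L)
    {v : HeightOneSpectrum (𝓞 ↥(maximalRealSubfield L))} (w : PlacesOver L v) (hw : IsCMField.complexConj L • w.1 = w.1)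
    (γH : (cmDatum L 2 (Matrix.of fun i j : Fin 2 => if i.val + j.val + 1 = 2 then (1 : L) else 0)).Local v ×
      (cmDatum L 1 (Matrix.of fun i j : Fin 1 => if i.val + j.val + 1 = 1 then (1 : L) else 0)).Local v)
    (δ δ' : (cmDatum L 3 H').Local v)
    {c θ θ' : LocalRing L v} (hc : Valued.v (c w) = WithZero.exp (-1 : ℤ))
    (hθθ' : conjLocal L (IsCMField.complexConj L) v θ = θ') (hθ : θ + θ' = 1) (hθv : Valued.v (θ w) ≤ 1)
    (hdeep : ∀ i j, Valued.v (((((endoEmbLocal L v γH).val : GL (Fin 3) (LocalRing L v)).val.map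
        (Pi.evalRingHom (fun w' : PlacesOver L v => w'.1.adicCompletion L) w)) - 1) i j) ≤ Valued.v (c w) ^ 2)
    (h : IsLocalNormPair L H' v γH δ)
    (hδ : ((δ'.val : GL (Fin 3) (LocalRing L v)).val : Matrix (Fin 3) (Fin 3) (LocalRing L v)) =
      (θ • ((δ.val : GL (Fin 3) (LocalRing L v)).val : Matrix (Fin 3) (Fin 3) (LocalRing L v)) + (c - θ) • 1) *
        ((c - θ') • ((δ.val : GL (Fin 3) (LocalRing L v)).val : Matrix (Fin 3) (Fin 3) (LocalRing L v)) + θ' • 1)⁻¹) :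
    ((δ'.val : GL (Fin 3) (LocalRing L v)).val.map (Pi.evalRingHom (fun w' : PlacesOver L v => w'.1.adicCompletion L) w)) ∈
        Algebra.adjoin 𝒪[w.1.adicCompletion L] ({1 + (c w)⁻¹ • (((δ.val : GL (Fin 3) (LocalRing L v)).val.map
          (Pi.evalRingHom (fun w' : PlacesOver L v => w'.1.adicCompletion L) w)) - 1)} : Set (Matrix (Fin 3) (Fin 3) (w.1.adicCompletion L))) ∧
      ((δ'.val : GL (Fin 3) (LocalRing L v)).val.map (Pi.evalRingHom (fun w' : PlacesOver L v => w'.1.adicCompletion L) w))⁻¹ ∈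
        Algebra.adjoin 𝒪[w.1.adicCompletion L] ({1 + (c w)⁻¹ • (((δ.val : GL (Fin 3) (LocalRing L v)).val.map
          (Pi.evalRingHom (fun w' : PlacesOver L v => w'.1.adicCompletion L) w)) - 1)} : Set (Matrix (Fin 3) (Fin 3) (w.1.adicCompletion L))) ∧
      (1 + (c w)⁻¹ • (((δ.val : GL (Fin 3) (LocalRing L v)).val.map (Pi.evalRingHom (fun w' : PlacesOver L v => w'.1.adicCompletion L) w)) - 1)) ∈
        Algebra.adjoin 𝒪[w.1.adicCompletion L] ({((δ'.val : GL (Fin 3) (LocalRing L v)).val.map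
          (Pi.evalRingHom (fun w' : PlacesOver L v => w'.1.adicCompletion L) w))} : Set (Matrix (Fin 3) (Fin 3) (w.1.adicCompletion L))) := by
  have hv : Subsingleton (PlacesOver L v) := PlacesOver.subsingleton_of_smul_eq (IsCMField.complexConj L) (IsCMField.complexConj_ne_one L) w hw
  set evw : LocalRing L v →+* w.1.adicCompletion L := Pi.evalRingHom (fun w' : PlacesOver L v => w'.1.adicCompletion L) w with hevw
  set O : Subring (w.1.adicCompletion L) := 𝒪[w.1.adicCompletion L] with hOdef
  have hO : ∀ {z : w.1.adicCompletion L}, z ∈ O ↔ Valued.v z ≤ 1 := fun {z} => Valuation.mem_integer_iff _ _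
  set σw := galAdicCompletionMap (L := L) (IsCMField.complexConj L) hw with hσw
  have hσ : ∀ x, Valued.v (σw x) = Valued.v x := fun x => valued_galAdicCompletionMap (L := L) (IsCMField.complexConj L) hw x
  set cw : w.1.adicCompletion L := c w with hcw
  set θw : w.1.adicCompletion L := θ w with hθwdef
  set θ'w : w.1.adicCompletion L := θ' w with hθ'wdef
  set ιw : Matrix (Fin 3) (Fin 3) (w.1.adicCompletion L) := (((endoEmbLocal L v γH).val : GL (Fin 3) (LocalRing L v)).val.map evw) with hιw
  set δw : Matrix (Fin 3) (Fin 3) (w.1.adicCompletion L) := ((δ.val : GL (Fin 3) (LocalRing L v)).val.map evw) with hδw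
  obtain ⟨hc0, hc1, -, -, -, -⟩ := shift_parameter_facts hc
  -- the scalars at `w`: `θ_w + θ′_w = 1`, `θ′_w = σ_w θ_w`, `|θ′_w| = 1`, `|c_w − θ′_w| = 1`, `|1 − c_w| = 1`
  have hθw : θw + θ'w = 1 := congrFun hθ w
  have hσθ : σw θw = θ'w := by
    have h' := congrFun hθθ' w
    rw [conjLocal_apply_eq_of_smul_eq (IsCMField.complexConj L) (IsCMField.complexConj_ne_one L) v w hw] at h'
    exact h'
  have hθσ : θw + σw θw = 1 := by rw [hσθ]; exact hθw
  obtain ⟨hθ'1, -, hct1⟩ := valued_map_eq_one_of_add_map_eq_one σw hσ hθv hθσ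
  have hθ'v : Valued.v θ'w ≤ 1 := by rw [← hσθ]; exact hθ'1.le
  have hct : Valued.v (cw - θ'w) = 1 := by rw [← hσθ]; exact hct1 hc1
  have h1c : Valued.v (1 - cw) = 1 := Valuation.map_one_sub_of_lt _ hc1
  -- `W = c_w⁻¹(ι_w − 1)`, `ι_w = 1 + c_w W`, and 2-deepness: `|W_{ij}| ≤ |c_w| < 1`
  set W : Matrix (Fin 3) (Fin 3) (w.1.adicCompletion L) := cw⁻¹ • (ιw - 1) with hW
  have hιW : ιw = 1 + cw • W := eq_one_add_smul_inv_smul_sub_one hc0 ιw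
  clear_value W
  have hWc : ∀ i j, Valued.v (W i j) ≤ Valued.v cw := by
    intro i j
    rw [hW, Matrix.smul_apply, smul_eq_mul, map_mul, map_inv₀]
    have hdij := hdeep i j
    have hvc0 : Valued.v cw ≠ 0 := (Valuation.ne_zero_iff _).2 hc0
    calc (Valued.v cw)⁻¹ * Valued.v ((ιw - 1) i j) ≤ (Valued.v cw)⁻¹ * Valued.v cw ^ 2 := mul_le_mul_right hdij _
      _ = Valued.v cw := by rw [sq, ← mul_assoc, inv_mul_cancel₀ hvc0, one_mul]
  have hWi : ∀ i j, Valued.v (W i j) ≤ 1 := fun i j => (hWc i j).trans hc1.le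
  have hWO : ∀ i j, W i j ∈ O := fun i j => hO.2 (hWi i j)
  have hcO : cw ∈ O := hO.2 hc1.le
  have hθO : θw ∈ O := hO.2 hθv
  have hθ'O : θ'w ∈ O := hO.2 hθ'v
  have htO : cw - θ'w ∈ O := hO.2 hct.le
  -- the determinants of `N₊ = 1 + θ_w W`, `N₋ = 1 + (c_w − θ′_w)W` are units: `tW ≡ 0 (mod 𝔪)` for `t` integral (★ `v_det_eq_one_of_forall_v_sub_one_lt_one`) — no `2`
  have hdet : ∀ {t : w.1.adicCompletion L}, Valued.v t ≤ 1 →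
      Valued.v (((1 : w.1.adicCompletion L) • (1 : Matrix (Fin 3) (Fin 3) (w.1.adicCompletion L)) + t • W).det) = 1 := by
    intro t ht
    rw [one_smul]
    refine v_det_eq_one_of_forall_v_sub_one_lt_one _ fun i k => ?_
    rw [add_sub_cancel_left, Matrix.smul_apply, smul_eq_mul, map_mul]
    exact lt_of_le_of_lt (mul_le_of_le_one_left' ht) ((hWc i k).trans_lt hc1)
  have hunit : ∀ {z : w.1.adicCompletion L}, Valued.v z = 1 → ∃ d ∈ O, d * z = 1 := fun {z} hz => by
    have hz0 : z ≠ 0 := fun h0 => by rw [h0, map_zero] at hz; exact zero_ne_one hz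
    exact ⟨z⁻¹, hO.2 (by rw [map_inv₀, hz, inv_one]), inv_mul_cancel₀ hz0⟩
  have hm : ∃ d ∈ O, d * ((1 : w.1.adicCompletion L) • (1 : Matrix (Fin 3) (Fin 3) (w.1.adicCompletion L)) + (cw - θ'w) • W).det = 1 := hunit (hdet hct.le)
  have hp : ∃ d ∈ O, d * ((1 : w.1.adicCompletion L) • (1 : Matrix (Fin 3) (Fin 3) (w.1.adicCompletion L)) + θw • W).det = 1 := hunit (hdet hθv)
  have h1cO : ∃ e ∈ O, e * (1 - cw) = 1 := hunit h1c
  have hctO : ∃ e ∈ O, e * (cw - θ'w) = 1 := hunit hct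
  -- ★ P4: the 2-free order identities for `W`
  set Y₀ : Matrix (Fin 3) (Fin 3) (w.1.adicCompletion L) := ((1 : w.1.adicCompletion L) • (1 : Matrix (Fin 3) (Fin 3) (w.1.adicCompletion L)) + θw • W) *
    ((1 : w.1.adicCompletion L) • (1 : Matrix (Fin 3) (Fin 3) (w.1.adicCompletion L)) + (cw - θ'w) • W)⁻¹ with hY₀
  have hY₀mem : Y₀ ∈ Algebra.adjoin O ({W} : Set (Matrix (Fin 3) (Fin 3) (w.1.adicCompletion L))) := hermitianMoebius_mem_adjoin O hWO hθO htO hm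
  have hY₀inv : Y₀⁻¹ ∈ Algebra.adjoin O ({W} : Set (Matrix (Fin 3) (Fin 3) (w.1.adicCompletion L))) := hermitianMoebius_inv_mem_adjoin O hWO hθO htO hm hp
  have hWmem : W ∈ Algebra.adjoin O ({Y₀} : Set (Matrix (Fin 3) (Fin 3) (w.1.adicCompletion L))) := mem_adjoin_hermitianMoebius O hWO hθO hθ'O hcO hθw h1cO hctO hm
  -- the match: `δ_w = x_w ι_w x_w⁻¹`
  obtain ⟨x, hx⟩ := isConj_iff.1 h
  have hxdet : IsUnit (((x : GL (Fin 3) (LocalRing L v)) : Matrix (Fin 3) (Fin 3) (LocalRing L v)).map evw).det := by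
    rw [← RingHom.mapMatrix_apply, ← RingHom.map_det]; exact (Matrix.isUnits_det_units x).map _
  set P : GL (Fin 3) (w.1.adicCompletion L) := Matrix.nonsingInvUnit _ hxdet with hP
  have hPv : (P : Matrix (Fin 3) (Fin 3) (w.1.adicCompletion L)) = ((x : GL (Fin 3) (LocalRing L v)) : Matrix (Fin 3) (Fin 3) (LocalRing L v)).map evw := rfl
  have hPi : ((P⁻¹ : GL (Fin 3) (w.1.adicCompletion L)) : Matrix (Fin 3) (Fin 3) (w.1.adicCompletion L)) = (((x : GL (Fin 3) (LocalRing L v)) : Matrix (Fin 3) (Fin 3) (LocalRing L v)).map evw)⁻¹ := by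
    rw [Matrix.coe_units_inv, hPv]
  have hmx : ((δ.val : GL (Fin 3) (LocalRing L v)).val : Matrix (Fin 3) (Fin 3) (LocalRing L v)) =
      (x : GL (Fin 3) (LocalRing L v)).val * (((endoEmbLocal L v γH).val : GL (Fin 3) (LocalRing L v)).val) * (x⁻¹ : GL (Fin 3) (LocalRing L v)).val := by
    rw [← hx, Units.val_mul, Units.val_mul]; rfl
  have hδconj : δw = (P : Matrix (Fin 3) (Fin 3) (w.1.adicCompletion L)) * ιw * ((P⁻¹ : GL (Fin 3) (w.1.adicCompletion L)) : Matrix (Fin 3) (Fin 3) (w.1.adicCompletion L)) := by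
    rw [hδw, hmx, Matrix.map_mul, Matrix.map_mul, Matrix.coe_units_inv, map_nonsing_inv_of_isUnit evw _ (Matrix.isUnits_det_units x), hPi, hPv]
  -- `φ_θ(ι_w) = Y₀`: both sides are `c_w` times a cofactor (★ P3 `hermitianMoebius_one_add_smul_eq`)
  have hNu : IsUnit ((1 : Matrix (Fin 3) (Fin 3) (w.1.adicCompletion L)) + (cw - θ'w) • W).det := by
    obtain ⟨d, -, hd⟩ := hm; rw [one_smul] at hd; exact IsUnit.of_mul_eq_one_right d hd
  have hDι : IsUnit ((cw - θ'w) • ιw + θ'w • (1 : Matrix (Fin 3) (Fin 3) (w.1.adicCompletion L))).det := by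
    rw [hιW, smul_one_add_smul_add_smul_one_of_add_eq W cw (cw - θ'w) θ'w (by ring), Matrix.det_smul]
    exact (IsUnit.pow _ (isUnit_iff_ne_zero.2 hc0)).mul hNu
  have hφι : (θw • ιw + (cw - θw) • (1 : Matrix (Fin 3) (Fin 3) (w.1.adicCompletion L))) * ((cw - θ'w) • ιw + θ'w • (1 : Matrix (Fin 3) (Fin 3) (w.1.adicCompletion L)))⁻¹ = Y₀ := by
    rw [hιW, hY₀, one_smul]; exact hermitianMoebius_one_add_smul_eq W hc0 θw θ'w hNu
  -- the `E_v`-level denominator of `δ` is a unit (one place above `v`; its `w`-component is `det P · (c_w³ det N₋) · det P⁻¹`)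
  have hDδ : IsUnit ((c - θ') • ((δ.val : GL (Fin 3) (LocalRing L v)).val : Matrix (Fin 3) (Fin 3) (LocalRing L v)) + θ' • (1 : Matrix (Fin 3) (Fin 3) (LocalRing L v))).det := by
    refine isUnit_localRing_of_ne_zero_of_subsingleton L v hv fun h0 => ?_
    have hw0 := congrFun h0 w
    have e1 : (((c - θ') • ((δ.val : GL (Fin 3) (LocalRing L v)).val : Matrix (Fin 3) (Fin 3) (LocalRing L v)) + θ' • (1 : Matrix (Fin 3) (Fin 3) (LocalRing L v))).det) w =
        ((cw - θ'w) • δw + θ'w • (1 : Matrix (Fin 3) (Fin 3) (w.1.adicCompletion L))).det := by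
      have e0 : (((c - θ') • ((δ.val : GL (Fin 3) (LocalRing L v)).val : Matrix (Fin 3) (Fin 3) (LocalRing L v)) + θ' • (1 : Matrix (Fin 3) (Fin 3) (LocalRing L v))).det) w =
          evw (((c - θ') • ((δ.val : GL (Fin 3) (LocalRing L v)).val : Matrix (Fin 3) (Fin 3) (LocalRing L v)) + θ' • (1 : Matrix (Fin 3) (Fin 3) (LocalRing L v))).det) := rfl
      rw [e0, RingHom.map_det, RingHom.mapMatrix_apply, map_smul_add_smul_one]
      rfl
    rw [e1, Pi.zero_apply, hδconj, smul_units_conj_add_smul_one P ιw (cw - θ'w) θ'w, Matrix.det_units_conj] at hw0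
    exact hDι.ne_zero hw0
  -- `φ_θ(δ)_w = P·Y₀·P⁻¹` (★ p853671 `map_genMoebius`, ★ P1 `moebius_conj'`) and `X_δ = P(1 + W)P⁻¹`
  have hYw : ((δ'.val : GL (Fin 3) (LocalRing L v)).val.map evw) = (P : Matrix (Fin 3) (Fin 3) (w.1.adicCompletion L)) * Y₀ * ((P⁻¹ : GL (Fin 3) (w.1.adicCompletion L)) : Matrix (Fin 3) (Fin 3) (w.1.adicCompletion L)) := by
    rw [hδ, map_genMoebius evw _ _ _ _ _ hDδ, map_sub, map_sub]
    change (θw • δw + (cw - θw) • (1 : Matrix (Fin 3) (Fin 3) (w.1.adicCompletion L))) * ((cw - θ'w) • δw + θ'w • 1)⁻¹ = _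
    rw [hδconj, Matrix.coe_units_inv, moebius_conj' _ _ (Matrix.isUnits_det_units P) _ _ _ _ hDι, hφι]
  have hXw : 1 + cw⁻¹ • (δw - 1) = (P : Matrix (Fin 3) (Fin 3) (w.1.adicCompletion L)) * (1 + W) * ((P⁻¹ : GL (Fin 3) (w.1.adicCompletion L)) : Matrix (Fin 3) (Fin 3) (w.1.adicCompletion L)) := by
    have h1 := smul_units_conj_add_smul_one P ιw cw⁻¹ (1 - cw⁻¹)
    have e2 : cw⁻¹ • ιw + (1 - cw⁻¹) • (1 : Matrix (Fin 3) (Fin 3) (w.1.adicCompletion L)) = 1 + W := by rw [hW, smul_sub, sub_smul, one_smul]; abel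
    rw [e2] at h1
    rw [← h1, hδconj, smul_sub, sub_smul, one_smul]
    abel
  -- transport of the three memberships along `P`
  refine ⟨?_, ?_, ?_⟩
  · rw [hYw]
    change _ ∈ Algebra.adjoin O ({1 + cw⁻¹ • (δw - 1)} : Set (Matrix (Fin 3) (Fin 3) (w.1.adicCompletion L)))
    rw [hXw]
    exact conj_mem_adjoin_of_mem_adjoin O P (mem_adjoin_one_add_of_mem_adjoin O hY₀mem)
  · rw [hYw, units_conj_nonsing_inv P Y₀ (by
      rw [hY₀, Matrix.det_mul]
      exact (by obtain ⟨d, -, hd⟩ := hp; exact IsUnit.of_mul_eq_one_right d hd : IsUnit _).mul (Matrix.isUnit_nonsing_inv_det _ (by rw [one_smul]; exact hNu)))]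
    change _ ∈ Algebra.adjoin O ({1 + cw⁻¹ • (δw - 1)} : Set (Matrix (Fin 3) (Fin 3) (w.1.adicCompletion L)))
    rw [hXw]
    exact conj_mem_adjoin_of_mem_adjoin O P (mem_adjoin_one_add_of_mem_adjoin O hY₀inv)
  · change 1 + cw⁻¹ • (δw - 1) ∈ Algebra.adjoin O ({((δ'.val : GL (Fin 3) (LocalRing L v)).val.map evw)} : Set (Matrix (Fin 3) (Fin 3) (w.1.adicCompletion L)))
    rw [hXw, hYw]
    exact conj_mem_adjoin_of_mem_adjoin O P (one_add_mem_adjoin_of_mem O hWmem)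

end Literature.NumberTheory.Rogawski1990

end
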